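import Summits.HodgeConjecture.HodgeConjecture.Theorems.R90S4U2OuterSimilSwap   -- ★ p03; brings ★ `QuadraticLocalNormGroupNonsplit` (`exists_norm_mul_of_not_exists_norm`, `exists_conjLocal_eq_not_exists_norm`, `exists_ne_zero_toLocalRing_eq_of_conjLocal_eq`), ★ `exists_complexConj_eq_neg_ne_zero`
import HarnessLib

/-!
# R90-TF · S4 «Ch. 13.1–2» — (SWAP) road, brick (b″) «NORM CLASSES IN `F_v`-CURRENCY»: the parameters `a`, `norm` and the index-two clause (X) of the
# orbit argument ★ `R90S4GenericityOrbit.orbit_contradiction`, read on `F_v = L⁺_v` through `ι_v = toLocalRing L v`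

Cell `hodgecm-mathlib`, crux H413 (`stmt-HodgeConjecture-24833`, lane `--supports … --as helper`), route of record `HCCMUnconditional`
(count-neutral).  Programme R90-TF, section S4 = Rogawski Ch. 13.1–2 (base `R90-C131`); seat K2E3-p11 (g9) (W5 SWAP hand; R90 bus 2026-09-04T23:04Z
OFFER to R90-C131-p01 (g0)'s ASM-cm).  THEOREMS ONLY (no `def` ∕ instance ∕ notation ∕ named fact ∕ `sorry`); ★-only imports; never imports `Cruxes/…/Lines`.

THE POINT.  ★ `orbit_contradiction (Gen₁ Gen₂ norm : F → Prop) (a : F) (hA) (hE₁) (hE₂) (hI) (hT) (hX) : False` (R90-C131-p01, `R90S4GenericityOrbit` §4) is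
the pure-logic core of the Labesse–Langlands swap; its parameters live in the one-parameter field `F` of ★ p862846 `R90S4U2UnipotentOneParameter`, i.e.
`F_v = v.adicCompletion L⁺`.  This file supplies, in THAT currency, with «`n` is a norm» spelled INLINE as
`∃ z : LocalRing L v, IsUnit z ∧ toLocalRing L v n = conjLocal L c v z * z` (the norm test of ★ `QuadraticLocalNormGroupNonsplit`, read through `ι_v`):
* `exists_ne_zero_toLocalRing_not_norm` — (OUT) at a NON-SPLIT `v` there is `a ∈ F_v^×` with `ι_v a` NOT a norm (index two, ★ `exists_conjLocal_eq_not_exists_norm`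
  + ★ `exists_ne_zero_toLocalRing_eq_of_conjLocal_eq`): the multiplier of the outer similitude `diag(ι_v a, 1)` of ★ p862846 §6 (★ p03
  `exists_similitude_not_exists_norm` in `F_v`-coordinates);
* `toLocalRing_norm_ne_zero` — a norm parameter is `≠ 0`;
* `exists_norm_and_eq_mul_or` — (X) INDEX TWO: for `a` as in (OUT), any two `c₁, c₂ ∈ F_v^×` satisfy `c₂ = c₁ n` or `c₂ = c₁ a n` with `n` a norm
  (★ `exists_norm_mul_of_not_exists_norm`: two non-norm `σ`-fixed units differ by a norm; `r = ι_v(c₂ ∕ c₁)`).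
[Rogawski1990, §3.5 Prop. 3.5.2 (a) p. 26; §11.1 p. 161] [Omeara1963, §63B Prop. 63:13a] [LabesseLanglands1979]

HONEST LABEL: HC_CM is proved only modulo the 7 printed citations (2 remaining named inputs: hLiu418 = stmt-HodgeConjecture-24832,
h413 = stmt-HodgeConjecture-24833) until rung 0 closes; local algebra only, discharges nothing; (SWAP) stays OPEN until `ldsSwap_of_ldsTwo` lands.

## Mathlib ∕ tree search
Tree ★ reused: `exists_conjLocal_eq_not_exists_norm`, `exists_ne_zero_toLocalRing_eq_of_conjLocal_eq`, `exists_norm_mul_of_not_exists_norm`,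
`conjLocal_toLocalRing`, `UnitaryFinTopForm.exists_complexConj_eq_neg_ne_zero`, `toLocalRing_injective`.  Mathlib: `div_ne_zero`, `mul_div_cancel₀`,
`IsUnit.mul_left_injective`.  Dedup `rg "toLocalRing_not_norm|exists_norm_and_eq_mul_or"`: none.

## References
* [Rogawski1990] J. D. Rogawski, *Automorphic Representations of Unitary Groups in Three Variables* (1990), §3.5 Prop. 3.5.2 (a) p. 26, §11.1 p. 161.
* [Omeara1963] O. T. O'Meara, *Introduction to Quadratic Forms* (1963), §63B Prop. 63:13a.
* [LabesseLanglands1979] J.-P. Labesse, R. P. Langlands, *L-indistinguishability for SL(2)*, Canad. J. Math. 31 (1979), §2.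
-/

set_option autoImplicit false
-- the mandated namespace (brief §3.4) repeats the single-problem summit's segment (`HodgeConjecture.HodgeConjecture`)
set_option linter.dupNamespace false

noncomputable section

open NumberField IsDedekindDomain
open Literature.NumberTheory.Automorphic Literature.NumberTheory.Automorphic.UnitaryGroup

namespace Summit.HodgeConjecture.HodgeConjecture.R90.S4

variable (L : Type) [Field L] [NumberField L] [IsCMField L] (v : HeightOneSpectrum (𝓞 ↥(maximalRealSubfield L)))

/-- **(OUT) A NON-NORM PARAMETER `a ∈ F_v^×` at a non-split place**: some `a ≠ 0` in `F_v` has `ι_v a` not of the form `σ(z) z` with `z` a unit of `E_v`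
(index two of the norm group, ★ `exists_conjLocal_eq_not_exists_norm`; `σ`-fixed units come from `F_v`, ★ `exists_ne_zero_toLocalRing_eq_of_conjLocal_eq`).
[cite: Rogawski1990, §3.5 Prop. 3.5.2 (a) p. 26] [cite: Omeara1963, §63B Prop. 63:13a] -/
theorem exists_ne_zero_toLocalRing_not_norm (hns : ∀ w : PlacesOver L v, IsCMField.complexConj L • w.1 = w.1) :
    ∃ a : v.adicCompletion ↥(maximalRealSubfield L), a ≠ 0 ∧
      ¬ ∃ z : LocalRing L v, IsUnit z ∧ toLocalRing L v a = conjLocal L (IsCMField.complexConj L) v z * z := by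
  obtain ⟨δ, hcδ, hδ⟩ := Literature.NumberTheory.Weil1982.UnitaryFinTopForm.exists_complexConj_eq_neg_ne_zero L
  obtain ⟨w⟩ : Nonempty (PlacesOver L v) := inferInstance
  obtain ⟨r, hr, hru, hnr⟩ := exists_conjLocal_eq_not_exists_norm L v (IsCMField.complexConj L) hcδ hδ w (hns w)
  obtain ⟨a, ha, rfl⟩ := exists_ne_zero_toLocalRing_eq_of_conjLocal_eq L v (IsCMField.complexConj L) hcδ hδ hr hru
  exact ⟨a, ha, hnr⟩

omit [IsCMField L] in
/-- A norm parameter `n` (`ι_v n = σ(z) z`, `z` a unit) is non-zero (`ι_v 0 = 0` is not a unit). [cite: Rogawski1990, §3.5 Prop. 3.5.2 (a) p. 26] -/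
theorem toLocalRing_norm_ne_zero {n : v.adicCompletion ↥(maximalRealSubfield L)} {σ : LocalRing L v →+* LocalRing L v}
    (hn : ∃ z : LocalRing L v, IsUnit z ∧ toLocalRing L v n = σ z * z) : n ≠ 0 := by
  rintro rfl
  obtain ⟨z, hz, h⟩ := hn
  rw [map_zero] at h
  exact not_isUnit_zero (h ▸ (hz.map σ).mul hz)

/-- **(X) INDEX TWO IN `F_v`-CURRENCY.**  At a NON-SPLIT `v`, let `a ∈ F_v^×` with `ι_v a` a non-norm.  Then any two non-zero parameters
`c₁, c₂ ∈ F_v` differ by a norm or by `a` times a norm: `∃ n, (ι_v n = σ(z) z, z unit) ∧ (c₂ = c₁ n ∨ c₂ = c₁ a n)` — `r = ι_v(c₂ ∕ c₁)` is a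
`σ`-fixed unit; if it is a norm take `n = c₂ ∕ c₁`, else `r = σ(z) z · ι_v a` (★ `exists_norm_mul_of_not_exists_norm`, index two) and `n = c₂ ∕ (c₁ a)`.
The clause (X) of ★ `R90S4GenericityOrbit.orbit_contradiction`. [cite: Rogawski1990, §3.5 Prop. 3.5.2 (a) p. 26; §11.1 p. 161] [cite: Omeara1963, §63B Prop. 63:13a] -/
theorem exists_norm_and_eq_mul_or (hns : ∀ w : PlacesOver L v, IsCMField.complexConj L • w.1 = w.1)
    {a : v.adicCompletion ↥(maximalRealSubfield L)} (ha : a ≠ 0)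
    (hna : ¬ ∃ z : LocalRing L v, IsUnit z ∧ toLocalRing L v a = conjLocal L (IsCMField.complexConj L) v z * z)
    (c₁ c₂ : v.adicCompletion ↥(maximalRealSubfield L)) (hc₁ : c₁ ≠ 0) (hc₂ : c₂ ≠ 0) :
    ∃ n : v.adicCompletion ↥(maximalRealSubfield L),
      (∃ z : LocalRing L v, IsUnit z ∧ toLocalRing L v n = conjLocal L (IsCMField.complexConj L) v z * z) ∧
        (c₂ = c₁ * n ∨ c₂ = c₁ * a * n) := by
  by_cases hnorm : ∃ z : LocalRing L v, IsUnit z ∧ toLocalRing L v (c₂ / c₁) = conjLocal L (IsCMField.complexConj L) v z * z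
  · exact ⟨c₂ / c₁, hnorm, Or.inl (mul_div_cancel₀ c₂ hc₁).symm⟩
  · obtain ⟨δ, hcδ, hδ⟩ := Literature.NumberTheory.Weil1982.UnitaryFinTopForm.exists_complexConj_eq_neg_ne_zero L
    obtain ⟨w⟩ : Nonempty (PlacesOver L v) := inferInstance
    have hau : IsUnit (toLocalRing L v a) := (isUnit_iff_ne_zero.2 ha).map _
    have hru : IsUnit (toLocalRing L v (c₂ / c₁)) := (isUnit_iff_ne_zero.2 (div_ne_zero hc₂ hc₁)).map _
    obtain ⟨z, hz, hzz⟩ := exists_norm_mul_of_not_exists_norm L v (IsCMField.complexConj L) hcδ hδ w (hns w)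
      (conjLocal_toLocalRing (IsCMField.complexConj L) v a) hau (conjLocal_toLocalRing (IsCMField.complexConj L) v (c₂ / c₁)) hru hna hnorm
    refine ⟨c₂ / (c₁ * a), ⟨z, hz, hau.mul_left_injective ?_⟩, Or.inr ?_⟩
    · -- `ι (c₂ ∕ (c₁ a)) · ι a = ι (c₂ ∕ c₁) = σ(z) z · ι a`
      change toLocalRing L v (c₂ / (c₁ * a)) * toLocalRing L v a = conjLocal L (IsCMField.complexConj L) v z * z * toLocalRing L v a
      rw [← hzz, ← map_mul]
      congr 1
      field_simp
    · field_simp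

end Summit.HodgeConjecture.HodgeConjecture.R90.S4

end
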